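import Mathlib.Analysis.Convex.SimplicialComplex.Basic
import Mathlib.Analysis.InnerProductSpace.PiL2
import Literature.Geometry.Riemannian.MinimalSegments
import Literature.Topology.Euclidean.InvarianceOfDomain
import HarnessLib

/-!
# The dimension clause of Buchner's triangulation theorem for the cut locus

Topic `Geometry/Riemannian`; third support file (after `CutLocusProofs.lean` and
`MinimalSegments.lean`) of the programme towards the named fact
`Literature.Geometry.Riemannian.buchner1977_cutLocus_triangulable` of `CutLocus.lean`
(M. A. Buchner, *Simplicial structure of the real analytic cut locus*, Proc. AMS 64 (1977)
118–121: on a compact real-analytic Riemannian manifold the cut locus `C(p)` is homeomorphic to a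
finite simplicial complex of dimension `≤ n - 1`, `n = dim M`; p. 118 quotes Myers' conjecture
"the locus in the analytic `n`-dimensional case is homeomorphic to a finite `(n-1)`-dimensional
complex").

The vendored statement has three conjuncts: the complex `K` (a Mathlib
`Geometry.SimplicialComplex ℝ (EuclideanSpace ℝ (Fin N))`) has finitely many faces, every face has
`≤ n` vertices, and `cutLocus g hg p ≃ₜ K.space`. This file PROVES that the dimension conjunct is
automatic: for a compact connected Riemannian manifold `M` of dimension `n` (any smoothness), ANY
simplicial complex whose polyhedron is homeomorphic to the metric cut locus `cutLocus g hg p` has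
only faces with `≤ n` vertices (`card_le_finrank_of_cutLocus_homeomorph`). Consequently Buchner's
fact reduces to bare triangulability (`buchner1977_cutLocus_triangulable_of_homeomorph`: the fact
follows from "`cutLocus g hg p` is homeomorphic to the polyhedron of a finite simplicial complex in
some Euclidean space", with no dimension bookkeeping) — i.e. to the subanalyticity of the cut locus
(Buchner, pp. 119–121) and Hironaka's triangulation of compact subanalytic sets, neither of which
is in the tree yet.

## The argument (topological dimension through invariance of domain)

* `interior (cutLocus g hg p) = ∅` on a compact connected manifold
  (`interior_cutLocus_eq_empty`, `MinimalSegments.lean`: interior points of minimal segments from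
  `p` are not cut points, and minimal segments reach every point).
* **Invariance of domain, maps into a manifold** (`isOpen_image_of_continuousOn_injOn`): a
  continuous injection from an open subset of a real normed space of dimension `dim E` into a
  manifold modelled on `E` has open image — read the map in an extended chart and apply Brouwer's
  theorem in `E` (`Literature.Topology.Euclidean.Brouwer.isOpen_image_of_injOn`; Tao 2014,
  Thm. 6.0.12). No boundarylessness is needed (the image automatically avoids the boundary).
* **Open simplices are parametrised by open subsets of `ℝ^{k}`**
  (`exists_continuous_injective_mapsTo_convexHull`): for an affinely independent finite set `s`
  with a chosen vertex `x₀`, the affine map `t ↦ x₀ + ∑ᵢ tᵢ (yᵢ - x₀)` over the other vertices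
  `yᵢ` is a continuous injection of `ℝ^{card s - 1}` sending the open corner
  `{tᵢ > 0, ∑ tᵢ < 1}` into `convexHull s`.
* Hence a face with `n + 1` vertices of a complex `K` with `K.space ≃ₜ cutLocus g hg p` would give a
  non-empty open subset of `M` inside the cut locus — contradiction.

No new definitions, no new named facts (D-0026); theorem-only file.

## References

* [Buchner1977Simplicial] M. A. Buchner, Simplicial structure of the real analytic cut locus,
  Proc. AMS 64 (1977) 118–121, p. 118 (Myers' conjecture, dimension `n - 1`).
* [Tao2014] T. Tao, Hilbert's fifth problem and related topics (2014), Thm. 6.0.12 (invariance of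
  domain), as vendored in `Literature/Topology/Euclidean/InvarianceOfDomain.lean`.
-/

noncomputable section

open Bundle Set Manifold Function
open scoped Manifold ContDiff Topology

namespace Literature.Geometry.Riemannian

open Literature.Geometry.Lorentzian (PseudoRiemannianMetric)

/-! ### Invariance of domain for maps into a manifold -/

section InvarianceOfDomain

variable {E : Type*} [NormedAddCommGroup E] [NormedSpace ℝ E] [FiniteDimensional ℝ E]
  {E' : Type*} [NormedAddCommGroup E'] [NormedSpace ℝ E'] [FiniteDimensional ℝ E']

/-- **Invariance of domain, maps into a manifold.** Let `M` be a manifold modelled on the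
finite-dimensional real normed space `E` (model with corners `I : ModelWithCorners ℝ E H`, no
smoothness or boundarylessness needed), `E'` a real normed space with `dim E' = dim E`, `U ⊆ E'`
open and `f : E' → M` continuous and injective on `U`. Then `f '' U` is open in `M`. Proof: near
`x ∈ U` read `f` in the extended chart `φ` at `f x`; `φ ∘ f` is a continuous injection of the open
set `U ∩ f ⁻¹' φ.source ⊆ E'` into `E`, so its image `W` is open by Brouwer's invariance of domain
(`Literature.Topology.Euclidean.Brouwer.isOpen_image_of_injOn`), and
`φ.source ∩ φ ⁻¹' W ⊆ f '' U` is an open neighbourhood of `f x`. [cite: Tao2014, Thm. 6.0.12] -/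
theorem isOpen_image_of_continuousOn_injOn {H : Type*} [TopologicalSpace H]
    (I : ModelWithCorners ℝ E H) {M : Type*} [TopologicalSpace M] [ChartedSpace H M]
    (hE : Module.finrank ℝ E' = Module.finrank ℝ E)
    {f : E' → M} {U : Set E'} (hU : IsOpen U) (hf : ContinuousOn f U) (hinj : InjOn f U) :
    IsOpen (f '' U) := by
  rw [isOpen_iff_mem_nhds]
  rintro _ ⟨x, hx, rfl⟩
  set φ := extChartAt I (f x) with hφ
  set V : Set E' := U ∩ f ⁻¹' φ.source with hV
  have hVo : IsOpen V := hf.isOpen_inter_preimage hU (isOpen_extChartAt_source (f x))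
  have hxV : x ∈ V := ⟨hx, mem_extChartAt_source (f x)⟩
  have hgc : ContinuousOn (φ ∘ f) V :=
    (continuousOn_extChartAt (f x)).comp (hf.mono inter_subset_left) fun y hy => hy.2
  have hgi : InjOn (φ ∘ f) V := fun y hy z hz h =>
    hinj hy.1 hz.1 ((extChartAt I (f x)).injOn hy.2 hz.2 h)
  have hopen : IsOpen ((φ ∘ f) '' V) :=
    Literature.Topology.Euclidean.Brouwer.isOpen_image_of_injOn hE hVo hgc hgi
  have hW : IsOpen (φ.source ∩ φ ⁻¹' ((φ ∘ f) '' V)) :=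
    (continuousOn_extChartAt (f x)).isOpen_inter_preimage (isOpen_extChartAt_source _) hopen
  have hsub : φ.source ∩ φ ⁻¹' ((φ ∘ f) '' V) ⊆ f '' U := by
    rintro y ⟨hy, z, hz, hzy⟩
    exact ⟨z, hz.1, (extChartAt I (f x)).injOn hz.2 hy hzy⟩
  exact Filter.mem_of_superset (hW.mem_nhds ⟨mem_extChartAt_source (f x), x, hxV, rfl⟩) hsub

end InvarianceOfDomain

/-! ### Open simplices contain injective continuous images of open subsets of `ℝᵏ` -/

section OpenSimplex

variable {V : Type*} [NormedAddCommGroup V] [NormedSpace ℝ V]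

/-- **An open corner of `ℝ^{card s - 1}` maps injectively into the simplex `convexHull s`.** Let
`s` be an affinely independent finite subset of a real normed space and `x₀ ∈ s`. Index the other
vertices by `ι = {j : s // j ≠ x₀}`. Then there are an open non-empty `U ⊆ ℝ^ι` and a continuous
injective `A : ℝ^ι → V` with `A '' U ⊆ convexHull s` — namely `A t = x₀ + ∑ᵢ tᵢ • (yᵢ - x₀)` and
`U = {t | 0 < tᵢ, ∑ tᵢ < 1}` (the vectors `yᵢ - x₀` are linearly independent,
`affineIndependent_iff_linearIndependent_vsub`, and `A t = (1 - ∑ tᵢ) x₀ + ∑ tᵢ yᵢ` is a convex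
combination of the vertices for `t ∈ U`). [folklore] -/
theorem exists_continuous_injective_mapsTo_convexHull {s : Finset V}
    (hind : AffineIndependent ℝ ((↑) : s → V)) {x₀ : V} (hx₀ : x₀ ∈ s) :
    ∃ (U : Set ({j : ↥s // j ≠ ⟨x₀, hx₀⟩} → ℝ)) (A : ({j : ↥s // j ≠ ⟨x₀, hx₀⟩} → ℝ) → V),
      IsOpen U ∧ U.Nonempty ∧ Continuous A ∧ Injective A ∧
        MapsTo A U (convexHull ℝ (s : Set V)) := by
  classical
  set a : ↥s := ⟨x₀, hx₀⟩ with ha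
  refine ⟨{t | (∀ i, 0 < t i) ∧ ∑ i, t i < 1},
    fun t => x₀ + ∑ i, t i • (((i.1 : ↥s) : V) - x₀), ?_, ?_, ?_, ?_, ?_⟩
  · -- `U` is open
    have h1 : IsOpen {t : {j : ↥s // j ≠ a} → ℝ | ∀ i, 0 < t i} := by
      rw [Set.setOf_forall]
      exact isOpen_iInter_of_finite fun i => isOpen_lt continuous_const (continuous_apply i)
    exact h1.and (isOpen_lt (continuous_finsetSum _ fun i _ => continuous_apply i) continuous_const)
  · -- `U` is non-empty: the point with all coordinates `1 / (card ι + 2)`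
    refine ⟨fun _ => 1 / ((Fintype.card {j : ↥s // j ≠ a} : ℝ) + 2), fun i => by positivity, ?_⟩
    show ∑ _i : {j : ↥s // j ≠ a}, 1 / ((Fintype.card {j : ↥s // j ≠ a} : ℝ) + 2) < 1
    rw [Finset.sum_const, Finset.card_univ, nsmul_eq_mul, mul_one_div,
      div_lt_one (by positivity)]
    linarith
  · -- `A` is continuous
    exact continuous_const.add
      (continuous_finsetSum _ fun i _ => (continuous_apply i).smul continuous_const)
  · -- `A` is injective: the edge vectors `yᵢ - x₀` are linearly independent
    have hli : LinearIndependent ℝ fun i : {j : ↥s // j ≠ a} => (((i.1 : ↥s) : V) - x₀) := by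
      have h := (affineIndependent_iff_linearIndependent_vsub ℝ ((↑) : ↥s → V) a).mp hind
      simpa only [vsub_eq_sub] using h
    intro t t' h
    have h' : ∑ i, t i • (((i.1 : ↥s) : V) - x₀) = ∑ i, t' i • (((i.1 : ↥s) : V) - x₀) :=
      add_left_cancel h
    have h0 : ∑ i, (t i - t' i) • (((i.1 : ↥s) : V) - x₀) = 0 := by
      simp only [sub_smul, Finset.sum_sub_distrib, h', sub_self]
    funext i
    exact sub_eq_zero.mp (Fintype.linearIndependent_iff.mp hli (fun i => t i - t' i) h0 i)
  · -- `A '' U ⊆ convexHull s`: `A t` is a convex combination of the vertices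
    rintro t ⟨hpos, hsum⟩
    have hmem : (1 - ∑ i, t i) • x₀ + ∑ i, t i • (((i.1 : ↥s) : V)) ∈
        convexHull ℝ (s : Set V) := by
      have h := (convex_convexHull ℝ (s : Set V)).sum_mem (t := Finset.univ)
        (w := fun o : Option {j : ↥s // j ≠ a} => o.elim (1 - ∑ i, t i) fun i => t i)
        (z := fun o : Option {j : ↥s // j ≠ a} => o.elim x₀ fun i => ((i.1 : ↥s) : V))
        ?_ ?_ ?_
      · simpa [Fintype.sum_option] using h
      · rintro (_ | i) -
        · simp only [Option.elim_none, sub_nonneg]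
          exact hsum.le
        · simp only [Option.elim_some]
          exact (hpos i).le
      · simp [Fintype.sum_option]
      · rintro (_ | i) -
        · exact subset_convexHull ℝ _ hx₀
        · exact subset_convexHull ℝ _ i.1.2
    have hA : x₀ + ∑ i, t i • (((i.1 : ↥s) : V) - x₀) =
        (1 - ∑ i, t i) • x₀ + ∑ i, t i • ((i.1 : ↥s) : V) := by
      simp only [smul_sub, Finset.sum_sub_distrib, ← Finset.sum_smul, sub_smul, one_smul]
      abel
    show x₀ + ∑ i, t i • (((i.1 : ↥s) : V) - x₀) ∈ convexHull ℝ (s : Set V)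
    rw [hA]
    exact hmem

end OpenSimplex

/-! ### The dimension clause: a triangulated cut locus has dimension `≤ n - 1` -/

section Dimension

variable {E : Type*} [NormedAddCommGroup E] [NormedSpace ℝ E] {H : Type*} [TopologicalSpace H]
  {I : ModelWithCorners ℝ E H} {M : Type*} [TopologicalSpace M] [ChartedSpace H M]
  [IsManifold I ∞ M] {n : ℕ∞ω} [FiniteDimensional ℝ E]
  {g : PseudoRiemannianMetric I n E (TangentSpace I : M → Type _)}

/-- **The dimension clause of Buchner's theorem is automatic.** Let `M` be a compact connected
Hausdorff manifold of dimension `n = dim E` with a Riemannian metric `g`, `p ∈ M`, and let `K` be a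
simplicial complex in some `EuclideanSpace ℝ (Fin N)` whose polyhedron is homeomorphic to the
(metric) cut locus of `p`. Then every face of `K` has at most `n` vertices (so `dim K ≤ n - 1`).
Proof: a face with `n + 1` (affinely independent) vertices contains a continuous injective image
of a non-empty open subset of `ℝⁿ` (`exists_continuous_injective_mapsTo_convexHull`); composing
with the homeomorphism gives a continuous injection of an open subset of `ℝⁿ` into `M` with image
inside the cut locus, open by invariance of domain (`isOpen_image_of_continuousOn_injOn`) — but the
cut locus has empty interior (`interior_cutLocus_eq_empty`). This is the "(`n-1`)-dimensional" of
Myers' conjecture as established by Buchner (p. 118), separated from the triangulability.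
[cite: Buchner1977Simplicial, p. 118] -/
theorem card_le_finrank_of_cutLocus_homeomorph [CompactSpace M] [T2Space M] [ConnectedSpace M]
    (hg : g.IsRiemannian) (p : M) {N : ℕ}
    {K : Geometry.SimplicialComplex ℝ (EuclideanSpace ℝ (Fin N))}
    (e : cutLocus g hg p ≃ₜ K.space) {s : Finset (EuclideanSpace ℝ (Fin N))} (hs : s ∈ K.faces) :
    s.card ≤ Module.finrank ℝ E := by
  classical
  by_contra hlt
  push Not at hlt
  -- a subface with exactly `n + 1` vertices
  obtain ⟨s', hs's, hcard⟩ := Finset.exists_subset_card_eq (Nat.succ_le_of_lt hlt)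
  have hs'ne : s'.Nonempty := Finset.card_pos.mp (by omega)
  have hs' : s' ∈ K.faces := K.down_closed hs hs's hs'ne
  obtain ⟨x₀, hx₀⟩ := hs'ne
  -- the parametrisation of the open simplex from the vertex `x₀`
  obtain ⟨U, A, hUo, hUne, hAc, hAi, hAU⟩ :=
    exists_continuous_injective_mapsTo_convexHull (K.indep hs') hx₀
  have hcardι : Fintype.card {j : ↥s' // j ≠ ⟨x₀, hx₀⟩} = Module.finrank ℝ E := by
    rw [Fintype.card_subtype_compl, Fintype.card_subtype_eq, Fintype.card_coe, hcard]
    rfl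
  have hE' : Module.finrank ℝ ({j : ↥s' // j ≠ ⟨x₀, hx₀⟩} → ℝ) = Module.finrank ℝ E := by
    rw [Module.finrank_fintype_fun_eq_card, hcardι]
  have hAK : ∀ t ∈ U, A t ∈ K.space := fun t ht => K.convexHull_subset_space hs' (hAU ht)
  -- the composite `U → K.space → cutLocus → M`, extended by junk outside `U`
  set F : ({j : ↥s' // j ≠ ⟨x₀, hx₀⟩} → ℝ) → M := fun t =>
    if h : A t ∈ K.space then ((e.symm ⟨A t, h⟩ : cutLocus g hg p) : M) else p with hF
  have hFU : ∀ t (ht : t ∈ U), F t = ((e.symm ⟨A t, hAK t ht⟩ : cutLocus g hg p) : M) :=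
    fun t ht => dif_pos (hAK t ht)
  have hFc : ContinuousOn F U := by
    rw [continuousOn_iff_continuous_restrict]
    have hrestr : U.restrict F =
        fun t : U => ((e.symm ⟨A t.1, hAK t.1 t.2⟩ : cutLocus g hg p) : M) :=
      funext fun t => hFU t.1 t.2
    rw [hrestr]
    exact continuous_subtype_val.comp
      (e.symm.continuous.comp ((hAc.comp continuous_subtype_val).subtype_mk fun t => hAK t.1 t.2))
  have hFi : InjOn F U := by
    intro t ht t' ht' h
    rw [hFU t ht, hFU t' ht'] at h
    have h2 := e.symm.injective (Subtype.ext h)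
    exact hAi (congrArg Subtype.val h2)
  have hopen : IsOpen (F '' U) := isOpen_image_of_continuousOn_injOn I hE' hUo hFc hFi
  have hsub : F '' U ⊆ cutLocus g hg p := by
    rintro _ ⟨t, ht, rfl⟩
    rw [hFU t ht]
    exact (e.symm ⟨A t, hAK t ht⟩).2
  have hint : (interior (cutLocus g hg p)).Nonempty :=
    (hUne.image F).mono (interior_maximal hsub hopen)
  rw [interior_cutLocus_eq_empty hg p] at hint
  exact Set.not_nonempty_empty hint

end Dimension

/-! ### Buchner's fact reduces to bare triangulability -/

section Reduction

universe u v w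

/-- **Buchner's theorem follows from the triangulability of the cut locus alone.** If on every
compact connected Hausdorff boundaryless real-analytic Riemannian manifold the metric cut locus of
every point is homeomorphic to the polyhedron of a finite simplicial complex in some Euclidean
space, then `buchner1977_cutLocus_triangulable` holds — the dimension bound `≤ n - 1` on the faces
being automatic (`card_le_finrank_of_cutLocus_homeomorph`). The hypothesis is exactly what
Buchner's paper proves from the subanalyticity of `C(p)` (pp. 119–121) and Hironaka's
triangulation of subanalytic sets; it is NOT vendored as a named fact (D-0026), only isolated
here as the remaining content of the fact. [cite: Buchner1977Simplicial, pp. 118 and 121] -/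
theorem buchner1977_cutLocus_triangulable_of_homeomorph
    (h : ∀ {E : Type u} [NormedAddCommGroup E] [NormedSpace ℝ E] [FiniteDimensional ℝ E]
      {H : Type v} [TopologicalSpace H] (I : ModelWithCorners ℝ E H) [I.Boundaryless]
      {M : Type w} [TopologicalSpace M] [ChartedSpace H M] [IsManifold I ω M]
      [CompactSpace M] [T2Space M] [ConnectedSpace M]
      (g : PseudoRiemannianMetric I ω E (TangentSpace I : M → Type _)) (hg : g.IsRiemannian)
      (p : M),
      ∃ (N : ℕ) (K : Geometry.SimplicialComplex ℝ (EuclideanSpace ℝ (Fin N))),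
        K.faces.Finite ∧ Nonempty (cutLocus g hg p ≃ₜ K.space)) :
    buchner1977_cutLocus_triangulable.{u, v, w} := by
  intro E _ _ _ H _ I _ M _ _ _ _ _ _ g hg p
  obtain ⟨N, K, hfin, ⟨e⟩⟩ := h I g hg p
  exact ⟨N, K, hfin, fun s hs => card_le_finrank_of_cutLocus_homeomorph hg p e hs, ⟨e⟩⟩

end Reduction

end Literature.Geometry.Riemannian

end
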